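import Literature.NumberTheory.EllipticCurves.Rubin1991.TwoVariableCMLines
import HarnessLib

/-!
# Twisted parallel lines in the two-variable receptacle `𝒪_{ℂ_p}⟦T₁⟧⟦T₂⟧`: transposition, the line
# `T₂ = a`, the unit twist `T ↦ u(1 + T) − 1`, their values, their reductions modulo `𝔪`, and the
# branch-of-a-twist corollary for de Shalit's two-variable frame `IsKatzMeasure₂` (all PROVED)

de Shalit 1987, II.4.17 (51)–(54) (p. 77–78): the two-variable `p`-adic `L` function
`L_{p,𝔣}(χ; s₁, s₂) = L_{p,𝔣}(χ κ₁^{−s₁} κ₂^{−s₂})`, i.e. `G(χ; T₁, T₂)` with `1 + T_i ↔ γ_i`, and its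
one-variable restrictions `G(χ₀; T)` (52)–(53) along `ℤ_p`-lines; twisting the branch character `χ₀` by a
character `η` of `Gal(K̃_∞/K)` moves the line: "`L_{p,𝔣}(χ, s) = G(χ₀; χ₁(γ₀)⁻¹u^s − 1)`" (52) — the
substitution `T ↦ u(1+T) − 1` with `u = η̂(γ)` and, in the second variable, the constant `η̂(γ') − 1`.
Companion of `Rubin1991/TwoVariableCMLines.lean` (cell `bsd-smallim`: the line `T₁ = c` in the OUTER
variable, `IntSeries.lineSubst`, its values `hasValueAt_lineSubst_iff`, and the parallel-line lemma for
unit content `isUnit_coeff_lineSubst_iff`) and of `Rubin1991/TwoVariableMainConjecture.lean` /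
`DeShalit1987/KatzPAdicLFunction.lean` (the frames `IsKatzMeasure₂`, `IsKatzBranch`).

Cell `bsd-eis` (FULL-BSD rank ≤ 1 programme D-0033; HOME `run/shared/lean/pub/bsd-eis/`), seat
`bsd-eis-k5-ty` gen 8 (typer), memo `HOME/k5-ty-g8/BR-OMEGA-ROAD.md`: the kernel lemmas (L1)–(L3) of
ROAD R-ψ for the residue [BRω] of crux 2 `GoodLatticeBDPValue` (stmt-BirchSwinnertonDyer-19032): the
anticyclotomic line of the two-variable Katz–de Shalit branch of the `p`-RAMIFIED character
`φ = ω̃ = ω·𝟙̃⁻¹` is, up to the frame's rigidity, the line `T₂ = a` of the branch of the `p`-UNRAMIFIED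
character `ψ = 𝟙̃` read through the unit twist `T₁ ↦ u(1+T₁) − 1` (`η = φ_K ψ_K ‖·‖` factors through
the cyclotomic `ℤ_p`-quotient; `a = η̂(γ') − 1 ∈ 𝔪`, `u = η̂(γ) ∈ 1 + 𝔪`), and BOTH operations preserve
the reduction modulo the maximal ideal `𝔪` of `𝒪_{ℂ_p}` — so "`μ = 0`" and the index of the first unit
coefficient (the analytic `λ`) are the same on the twisted parallel line as on the axis `T₂ = 0`:
Castella–Grossi–Lee–Skinner 2022, proof of Thm. 2.2.2, (2.16) "since `ψ = φ⁻¹ω`, the functional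
equation for the Katz `p`-adic `L`-function yields `λ(𝓛_ψ) = λ(𝓛_φ)`", in the tree's currency. No
named fact, no `sorry`, no `instance`, no notation: definitions with bodies and proved lemmas only
(net declared debt 0).

## Contents

* §1 `IntSeries.transpose G` (swap `T₁ ↔ T₂`), `coeff_coeff_transpose`, `transpose_transpose`,
  `constantCoeff_transpose` (`= PowerSeries.map constantCoeff G`, the inner line `T₂ = 0` of the
  (F)-file's `IsKatzMeasure₂.isKatzBranch_map_constantCoeff`), `hasValueAt₂_transpose_iff`
  (`G^t(x, y) = G(y, x)`), `IsKatzMeasure₂.transpose` (a frame for `(κ₁, κ₂; γ₁, γ₂)` transposed is a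
  frame for `(κ₂, κ₁; γ₂, γ₁)` — the receptacle the frame file's `hasValueAt₂_swap` did not construct);
  hence THE LINE `T₂ = a` is `lineSubst a (transpose G) ∈ 𝒪⟦T₁⟧` (`hasValueAt_lineSubst_transpose_iff`).
* §2 `IntSeries.unitTwist Q u` (`T ↦ u(1+T) − 1 = (u − 1) + uT`, coefficientwise
  `[T^k] = ∑_{j ≥ k} [T^j]Q · C(j,k) (u−1)^{j−k} u^k`; Mathlib's `PowerSeries.subst` does not apply —
  the constant term `u − 1` is topologically nilpotent, not nilpotent), `hasValueAt_unitTwist_iff`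
  (`(unitTwist Q u)(y) = Q(u(1+y) − 1)` for `‖u − 1‖, ‖y‖ < 1`).
* §3 reductions modulo `𝔪`: `coe_coeff_unitTwist_eq_add` (leading term + tail of norm `≤ ‖u − 1‖`),
  `isUnit_coeff_unitTwist_iff`, `map_residue_unitTwist` (`= Q.map residue`), `map_residue_lineSubst`
  (`= (constantCoeff G).map residue`, the residue form of `isUnit_coeff_lineSubst_iff`), and the composite
  `map_residue_unitTwist_lineSubst_transpose`.
* §4 values of the composite `hasValueAt_unitTwist_lineSubst_transpose_iff`
  (`P(y) = G(u(1+y) − 1, a)`) and the frame corollary `IsKatzMeasure₂.isKatzBranch_unitTwist_lineSubst`: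
  if `G` is the `λ`-branch of the two-variable measure for `(κ₁, κ₂; γ₁, γ₂)` and the points of the
  `κ₁`-line of the twist `λη` are transported to points of the pair with first coordinate multiplied by
  `u` and second coordinate `1 + a` (the consumer's avatar bookkeeping for `η`, stated as a hypothesis
  `hpt` so that no avatar algebra is fixed here), then `P = unitTwist (lineSubst a Gᵗ) u` is a
  `κ₁`-BRANCH (`DeShalit1987.IsKatzBranch`) of `λη` at `γ₁`.

## References

* [deShalit1987] E. de Shalit, *Iwasawa theory of elliptic curves with complex multiplication*,
  Perspectives in Math. 3 (1987), II.4.17 (51)–(54) (p. 77–78; store chunk 77–78).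
* [CastellaGrossiLeeSkinner2022] proof of Thm. 2.2.2, display (2.16) (arXiv:2008.02571v2 p. 12).
* [GreenbergVatsal2000] p. 2, (1)–(2) (`μ`, `λ` of a power series; unit content).
* Cell records: HOME/k5-ty-g8/BR-OMEGA-ROAD.md; STATUS 2026-08-27 (FINDING BRω-0).
-/

noncomputable section

open Filter Topology
open NumberField IsDedekindDomain Field
open Literature.NumberTheory.EllipticCurves.GreenbergVatsal2000
open Literature.NumberTheory.GaloisRepresentations Literature.NumberTheory.Automorphic

namespace Literature.NumberTheory.EllipticCurves

variable {p : ℕ} [Fact p.Prime]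

/-! ### §1. Transposition `T₁ ↔ T₂` and the line `T₂ = a` -/

namespace IntSeries

section Transpose

variable {R : Type*} [CommSemiring R]

/-- **Transposition of the two variables**: `[T₁^i T₂^j] Gᵗ = [T₁^j T₂^i] G` (`G ∈ R⟦T₁⟧⟦T₂⟧`, outer
`T₁`, inner `T₂`). Reading the two-variable function of II.4.17 (54) with the roles of `κ₁, κ₂`
exchanged. [cite: deShalit1987, II.4.17 (54) (p. 78)] -/
def transpose (G : PowerSeries (PowerSeries R)) : PowerSeries (PowerSeries R) :=
  PowerSeries.mk fun i => PowerSeries.mk fun j => PowerSeries.coeff i (PowerSeries.coeff j G)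

/-- Coefficients of the transpose. [cite: deShalit1987, II.4.17 (54) (p. 78)] -/
@[simp] theorem coeff_coeff_transpose (G : PowerSeries (PowerSeries R)) (i j : ℕ) :
    PowerSeries.coeff j (PowerSeries.coeff i (transpose G)) =
      PowerSeries.coeff i (PowerSeries.coeff j G) := by
  simp [transpose, PowerSeries.coeff_mk]

/-- Transposition is an involution. [cite: deShalit1987, II.4.17 (54) (p. 78)] -/
theorem transpose_transpose (G : PowerSeries (PowerSeries R)) : transpose (transpose G) = G := by
  ext i j
  simp

/-- **The inner axis `T₂ = 0` as a constant coefficient**: `constantCoeff Gᵗ = PowerSeries.map constantCoeff G`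
(the line of `IsKatzMeasure₂.isKatzBranch_map_constantCoeff`). [cite: deShalit1987, II.4.17 (52)–(54) (p. 77–78)] -/
theorem constantCoeff_transpose (G : PowerSeries (PowerSeries R)) :
    PowerSeries.constantCoeff (transpose G) = PowerSeries.map (PowerSeries.constantCoeff (R := R)) G := by
  ext j
  rw [← PowerSeries.coeff_zero_eq_constantCoeff_apply, coeff_coeff_transpose, PowerSeries.coeff_map,
    PowerSeries.coeff_zero_eq_constantCoeff_apply]

end Transpose

variable (G : PowerSeries (PowerSeries (PadicComplexInt p)))

/-- **Values of the transpose**: `Gᵗ` has value `v` at `(x, y)` iff `G` has value `v` at `(y, x)`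
(reindex the absolutely convergent double sum by `(i, j) ↦ (j, i)`).
[cite: deShalit1987, II.4.17 (54) (p. 78)] -/
theorem hasValueAt₂_transpose_iff (x y v : ℂ_[p]) :
    IntSeries.HasValueAt₂ (transpose G) x y v ↔ IntSeries.HasValueAt₂ G y x v := by
  unfold IntSeries.HasValueAt₂
  rw [← (Equiv.prodComm ℕ ℕ).hasSum_iff]
  refine Iff.of_eq (congrArg (fun f => HasSum f v) ?_)
  funext k
  simp only [Function.comp_apply, Equiv.prodComm_apply, Prod.fst_swap, Prod.snd_swap,
    coeff_coeff_transpose]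
  ring

/-- **The line `T₂ = a`** (`‖a‖, ‖x‖ < 1`): `lineSubst a Gᵗ ∈ 𝒪⟦T₁⟧` has value `v` at `x` iff `G` has
value `v` at `(x, a)`. [cite: deShalit1987, II.4.17 (52)–(54) (p. 77–78)] -/
theorem hasValueAt_lineSubst_transpose_iff {a : PadicComplexInt p} (ha : ‖(a : ℂ_[p])‖ < 1)
    {x : ℂ_[p]} (hx : ‖x‖ < 1) (v : ℂ_[p]) :
    IntSeries.HasValueAt (lineSubst a (transpose G)) x v ↔ IntSeries.HasValueAt₂ G x a v := by
  rw [hasValueAt_lineSubst_iff (transpose G) ha hx, hasValueAt₂_transpose_iff]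

end IntSeries

section Frame

variable {K : Type} [Field K] [NumberField K]
  {ι : PadicAlgCl p ≃+* ℂ} {v vbar : HeightOneSpectrum (𝓞 K)} {S : Finset (HeightOneSpectrum (𝓞 K))}
  {κ₁ κ₂ : ZpExtension K p} {γ₁ γ₂ : absoluteGaloisGroup K}
  {lam : HeckeCharacter K} {Ω δ : ℂ} {Ωp : ℂ_[p]} {G : PowerSeries (PowerSeries (PadicComplexInt p))}

/-- **A frame transposed is a frame for the swapped pair**: if `G` is the `λ`-branch of the two-variable
measure for `(κ₁, κ₂; γ₁, γ₂)` then `Gᵗ` is the `λ`-branch for `(κ₂, κ₁; γ₂, γ₁)` (the receptacle of the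
frame file's `IsKatzMeasure₂.hasValueAt₂_swap`). [cite: deShalit1987, II.4.17 (54) (p. 78)] -/
theorem IsKatzMeasure₂.transpose (hG : IsKatzMeasure₂ ι v vbar S κ₁ κ₂ γ₁ γ₂ lam Ω δ Ωp G) :
    IsKatzMeasure₂ ι v vbar S κ₂ κ₁ γ₂ γ₁ lam Ω δ Ωp (IntSeries.transpose G) := by
  intro ρ r m j hr hκ hjm hinf hunr hL
  rw [IntSeries.hasValueAt₂_transpose_iff]
  exact hG ρ r m j hr (fun σ h₁ h₂ => hκ σ h₂ h₁) hjm hinf hunr hL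

end Frame

/-! ### §2. The unit twist `T ↦ u(1 + T) − 1` -/

namespace IntSeries

variable (Q : PowerSeries (PadicComplexInt p))

/-- The general term `[T^j]Q · C(j,k) · (u−1)^{j−k} · u^k` of the `k`-th coefficient of the unit twist,
read in `ℂ_p` (zero for `j < k`). [cite: deShalit1987, II.4.17 (52) (p. 77)] -/
def twistTerm (u : ℂ_[p]) (k j : ℕ) : ℂ_[p] :=
  ((PowerSeries.coeff j Q : PadicComplexInt p) : ℂ_[p]) * (j.choose k : ℂ_[p]) *
    (u - 1) ^ (j - k) * u ^ k

/-- `‖u‖ = 1` when `‖u − 1‖ < 1` (ultrametric). [folklore] -/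
private theorem norm_eq_one_of_norm_sub_one_lt {u : ℂ_[p]} (hu : ‖u - 1‖ < 1) : ‖u‖ = 1 := by
  have h := norm_add_eq_one_iff_of_norm_lt_one (a := (1 : ℂ_[p])) (t := u - 1)
    (by rw [norm_one]) hu
  rw [add_sub_cancel, norm_one] at h
  exact h.mpr rfl

/-- A binomial coefficient has norm `≤ 1` in `ℂ_p`. [folklore] -/
private theorem norm_natCast_choose_le_one (j k : ℕ) : ‖((j.choose k : ℕ) : ℂ_[p])‖ ≤ 1 := by
  have h : ((j.choose k : ℕ) : ℂ_[p]) = (((j.choose k : ℕ) : PadicComplexInt p) : ℂ_[p]) := by simp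
  rw [h]
  exact norm_coe_padicComplexInt_le_one _

/-- For `j < k` the twist term vanishes (`C(j,k) = 0`). [folklore] -/
private theorem twistTerm_eq_zero_of_lt (u : ℂ_[p]) {k j : ℕ} (hjk : j < k) : twistTerm Q u k j = 0 := by
  simp [twistTerm, Nat.choose_eq_zero_of_lt hjk]

/-- The twist terms are dominated by `‖u − 1‖^{j−k}` (all other factors have norm `≤ 1`).
[cite: deShalit1987, II.4.17 (52) (p. 77)] -/
theorem norm_twistTerm_le {u : ℂ_[p]} (hu : ‖u - 1‖ < 1) (k j : ℕ) :
    ‖twistTerm Q u k j‖ ≤ ‖u - 1‖ ^ (j - k) := by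
  rw [twistTerm, norm_mul, norm_mul, norm_mul, norm_pow, norm_pow, norm_eq_one_of_norm_sub_one_lt hu,
    one_pow, mul_one]
  calc ‖((PowerSeries.coeff j Q : PadicComplexInt p) : ℂ_[p])‖ * ‖((j.choose k : ℕ) : ℂ_[p])‖ *
        ‖u - 1‖ ^ (j - k)
      ≤ 1 * 1 * ‖u - 1‖ ^ (j - k) := by
        gcongr
        · exact norm_coe_padicComplexInt_le_one _
        · exact norm_natCast_choose_le_one j k
    _ = ‖u - 1‖ ^ (j - k) := by ring

/-- For `‖u − 1‖ < 1` and fixed `k`, the series `∑_j` of twist terms converges: it is dominated by the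
shifted geometric series `‖u−1‖^{j−k}`. [cite: deShalit1987, II.4.17 (52) (p. 77)] -/
theorem summable_twistTerm {u : ℂ_[p]} (hu : ‖u - 1‖ < 1) (k : ℕ) :
    Summable fun j : ℕ => twistTerm Q u k j := by
  have hg : Summable fun j : ℕ => ‖u - 1‖ ^ (j - k) := by
    have h0 := summable_geometric_of_lt_one (norm_nonneg (u - 1)) hu
    -- `j ↦ j - k` is `k`-to-one onto `ℕ`; compare with `∑_j r^j` after the shift `j = i + k`
    rw [← summable_nat_add_iff k]
    simpa using h0
  exact hg.of_norm_bounded (norm_twistTerm_le Q hu k)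

/-- The `k`-th coefficient of the unit twist, as an element of `ℂ_p`: `∑_j [T^j]Q·C(j,k)(u−1)^{j−k}u^k`
(`tsum`; junk `0` if divergent). [cite: deShalit1987, II.4.17 (52) (p. 77)] -/
def twistCoeff (u : ℂ_[p]) (k : ℕ) : ℂ_[p] :=
  ∑' j : ℕ, twistTerm Q u k j

/-- Every twist coefficient lies in the unit ball when `‖u − 1‖ < 1` (ultrametric bound on a `tsum`
whose terms have norm `≤ 1`). [cite: deShalit1987, II.4.17 (52) (p. 77)] -/
theorem norm_twistCoeff_le_one {u : ℂ_[p]} (hu : ‖u - 1‖ < 1) (k : ℕ) : ‖twistCoeff Q u k‖ ≤ 1 :=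
  IsUltrametricDist.norm_tsum_le_of_forall_le_of_nonneg zero_le_one fun j =>
    (norm_twistTerm_le Q hu k j).trans (pow_le_one₀ (norm_nonneg _) hu.le)

/-- When `‖u − 1‖ < 1` fails the definition below still needs an element of `𝒪`; we use `0`-junk through
this total wrapper. [folklore] -/
def twistCoeffInt (u : PadicComplexInt p) (k : ℕ) : PadicComplexInt p :=
  if hu : ‖(u : ℂ_[p]) - 1‖ < 1 then
    ⟨twistCoeff Q (u : ℂ_[p]) k, mem_padicComplexInt_iff.mpr (norm_twistCoeff_le_one Q hu k)⟩
  else 0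

/-- **The unit twist `T ↦ u(1 + T) − 1`** of `Q ∈ 𝒪_{ℂ_p}⟦T⟧` (`u ∈ 𝒪`, meaningful for `‖u − 1‖ < 1`):
the series `Q((u − 1) + uT)` with `[T^k] = ∑_{j ≥ k} [T^j]Q · C(j,k) (u−1)^{j−k} u^k`. In Iwasawa-algebra
terms (`1 + T ↔ γ`) this is the automorphism `γ ↦ u·γ` of `𝒪⟦Γ⟧`, i.e. the twist of the measure by
the character `γ^x ↦ u^x`: de Shalit's "`L_{p,𝔣}(χ, s) = G(χ₀; χ₁(γ₀)⁻¹u^s − 1)`" (II.4.17 (52)) — the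
branch of `χ₀χ₁` is the branch of `χ₀` read at `T ↦ χ₁(γ₀)⁻¹(1+T) − 1`. Total (junk `0` for
`‖u − 1‖ = 1`). [cite: deShalit1987, II.4.17 (52) (p. 77)] -/
def unitTwist (u : PadicComplexInt p) : PowerSeries (PadicComplexInt p) :=
  PowerSeries.mk fun k => twistCoeffInt Q u k

/-- The coefficients of the unit twist, read in `ℂ_p`. [cite: deShalit1987, II.4.17 (52) (p. 77)] -/
theorem coe_coeff_unitTwist {u : PadicComplexInt p} (hu : ‖(u : ℂ_[p]) - 1‖ < 1) (k : ℕ) :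
    ((PowerSeries.coeff k (unitTwist Q u) : PadicComplexInt p) : ℂ_[p]) =
      ∑' j : ℕ, twistTerm Q (u : ℂ_[p]) k j := by
  rw [unitTwist, PowerSeries.coeff_mk, twistCoeffInt, dif_pos hu]
  rfl

/-- Absolute convergence of the double family `[T^j]Q·C(j,k)(u−1)^{j−k}u^k·y^k` on `‖u−1‖, ‖y‖ < 1`:
on its support `k ≤ j` it is bounded by `s^j s^k` with `s = max(‖u−1‖, ‖y‖)^{1/2} < 1`.
[cite: deShalit1987, II.4.17 (52) (p. 77)] -/
theorem summable_twistTerm_mul_pow {u y : ℂ_[p]} (hu : ‖u - 1‖ < 1) (hy : ‖y‖ < 1) :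
    Summable fun q : ℕ × ℕ => twistTerm Q u q.2 q.1 * y ^ q.2 := by
  -- q = (j, k)
  set r : ℝ := max ‖u - 1‖ ‖y‖ with hr
  have hr0 : 0 ≤ r := le_max_of_le_left (norm_nonneg _)
  have hr1 : r < 1 := max_lt hu hy
  set s : ℝ := Real.sqrt r with hs
  have hs0 : 0 ≤ s := Real.sqrt_nonneg _
  have hs1 : s < 1 := by
    rw [hs, Real.sqrt_lt' one_pos, one_pow]
    exact hr1
  have hss : s * s = r := Real.mul_self_sqrt hr0
  have hg : Summable fun q : ℕ × ℕ => s ^ q.1 * s ^ q.2 :=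
    (summable_geometric_of_lt_one hs0 hs1).mul_of_nonneg (summable_geometric_of_lt_one hs0 hs1)
      (fun _ => pow_nonneg hs0 _) (fun _ => pow_nonneg hs0 _)
  refine hg.of_norm_bounded fun q => ?_
  obtain ⟨j, k⟩ := q
  dsimp only
  by_cases hkj : k ≤ j
  · have h1 : ‖twistTerm Q u k j * y ^ k‖ ≤ r ^ (j - k) * r ^ k := by
      rw [norm_mul, norm_pow]
      refine mul_le_mul ((norm_twistTerm_le Q hu k j).trans ?_) ?_ (pow_nonneg (norm_nonneg _) _)
        (pow_nonneg hr0 _)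
      · exact pow_le_pow_left₀ (norm_nonneg _) (le_max_left _ _) _
      · exact pow_le_pow_left₀ (norm_nonneg _) (le_max_right _ _) _
    have h2 : r ^ (j - k) * r ^ k = r ^ j := by
      rw [← pow_add, Nat.sub_add_cancel hkj]
    have h3 : r ^ j ≤ s ^ j * s ^ k := by
      rw [← hss, mul_pow]
      exact mul_le_mul_of_nonneg_left (pow_le_pow_of_le_one hs0 hs1.le hkj) (pow_nonneg hs0 _)
    exact h1.trans (h2.le.trans h3)
  · rw [twistTerm_eq_zero_of_lt Q u (not_le.mp hkj), zero_mul, norm_zero]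
    exact mul_nonneg (pow_nonneg hs0 _) (pow_nonneg hs0 _)

/-- The binomial theorem in the shape of the twist: for fixed `j`,
`∑_k C(j,k)(u−1)^{j−k}(u y)^k = (u(1+y) − 1)^j`, as a `HasSum` over `ℕ` (support `k ≤ j`).
[folklore] -/
private theorem hasSum_twistTerm_mul_pow (u y : ℂ_[p]) (j : ℕ) :
    HasSum (fun k : ℕ => twistTerm Q u k j * y ^ k)
      (((PowerSeries.coeff j Q : PadicComplexInt p) : ℂ_[p]) * (u * (1 + y) - 1) ^ j) := by
  have hfin : ∀ k ∉ Finset.range (j + 1), twistTerm Q u k j * y ^ k = 0 := by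
    intro k hk
    rw [Finset.mem_range, not_lt] at hk
    rw [twistTerm_eq_zero_of_lt Q u (Nat.lt_of_succ_le hk), zero_mul]
  have key : ∑ k ∈ Finset.range (j + 1), twistTerm Q u k j * y ^ k =
      ((PowerSeries.coeff j Q : PadicComplexInt p) : ℂ_[p]) * (u * (1 + y) - 1) ^ j := by
    have hxy : u * (1 + y) - 1 = u * y + (u - 1) := by ring
    rw [hxy, add_pow, Finset.mul_sum]
    refine Finset.sum_congr rfl fun k hk => ?_
    rw [twistTerm, mul_pow]
    ring
  rw [← key]
  exact hasSum_sum_of_ne_finset_zero hfin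

/-- **Values of the unit twist**: for `‖u − 1‖ < 1` and `‖y‖ < 1`, `unitTwist Q u` has value `w` at `y`
iff `Q` has value `w` at `u(1 + y) − 1` (fibrewise summation of the absolutely convergent double family,
once over `k` — the binomial theorem — and once over `j`). [cite: deShalit1987, II.4.17 (52) (p. 77)] -/
theorem hasValueAt_unitTwist_iff {u : PadicComplexInt p} (hu : ‖(u : ℂ_[p]) - 1‖ < 1) {y : ℂ_[p]}
    (hy : ‖y‖ < 1) (w : ℂ_[p]) :
    IntSeries.HasValueAt (unitTwist Q u) y w ↔
      IntSeries.HasValueAt Q ((u : ℂ_[p]) * (1 + y) - 1) w := by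
  have hS := summable_twistTerm_mul_pow Q hu hy
  -- fibres over `j` (binomial theorem): the family sums to the value series of `Q` at `u(1+y) − 1`
  have hj : ∀ j : ℕ, HasSum (fun k : ℕ => twistTerm Q (u : ℂ_[p]) k j * y ^ k)
      (((PowerSeries.coeff j Q : PadicComplexInt p) : ℂ_[p]) * ((u : ℂ_[p]) * (1 + y) - 1) ^ j) :=
    fun j => hasSum_twistTerm_mul_pow Q (u : ℂ_[p]) y j
  have keyj := hS.hasSum.prod_fiberwise hj
  -- fibres over `k` (the coefficients of the twist)
  have h2 : HasSum (fun q : ℕ × ℕ => twistTerm Q (u : ℂ_[p]) q.1 q.2 * y ^ q.1)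
      (∑' q : ℕ × ℕ, twistTerm Q (u : ℂ_[p]) q.2 q.1 * y ^ q.2) :=
    ((Equiv.prodComm ℕ ℕ).hasSum_iff
      (f := fun q : ℕ × ℕ => twistTerm Q (u : ℂ_[p]) q.2 q.1 * y ^ q.2)).mpr hS.hasSum
  have hk : ∀ k : ℕ, HasSum (fun j : ℕ => twistTerm Q (u : ℂ_[p]) k j * y ^ k)
      (((PowerSeries.coeff k (unitTwist Q u) : PadicComplexInt p) : ℂ_[p]) * y ^ k) := by
    intro k
    rw [coe_coeff_unitTwist Q hu]
    exact (summable_twistTerm Q hu k).hasSum.mul_right (y ^ k)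
  have keyk := h2.prod_fiberwise hk
  unfold IntSeries.HasValueAt
  constructor
  · intro h
    rw [h.unique keyk]
    exact keyj
  · intro h
    rw [h.unique keyj]
    exact keyk

end IntSeries

/-! ### §3. Reductions modulo the maximal ideal of `𝒪_{ℂ_p}` -/

namespace IntSeries

variable (Q : PowerSeries (PadicComplexInt p)) (G : PowerSeries (PowerSeries (PadicComplexInt p)))

/-- An element of `𝒪_{ℂ_p}` has residue `0` iff its norm is `< 1` (the maximal ideal is the open unit
ball). [folklore] -/
private theorem residue_eq_zero_iff_norm_lt_one (x : PadicComplexInt p) :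
    IsLocalRing.residue (PadicComplexInt p) x = 0 ↔ ‖(x : ℂ_[p])‖ < 1 := by
  rw [IsLocalRing.residue_eq_zero_iff, IsLocalRing.mem_maximalIdeal, mem_nonunits_iff,
    isUnit_padicComplexInt_iff]
  exact ⟨fun h => lt_of_le_of_ne (norm_coe_padicComplexInt_le_one x) h, fun h => h.ne⟩

/-- Two elements of `𝒪_{ℂ_p}` whose difference has norm `< 1` have the same residue. [folklore] -/
private theorem residue_eq_of_norm_sub_lt_one {x y : PadicComplexInt p} (h : ‖(x : ℂ_[p]) - (y : ℂ_[p])‖ < 1) :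
    IsLocalRing.residue (PadicComplexInt p) x = IsLocalRing.residue (PadicComplexInt p) y := by
  rw [← sub_eq_zero, ← map_sub, residue_eq_zero_iff_norm_lt_one]
  simpa using h

/-- `‖u^k − 1‖ < 1` when `‖u − 1‖ < 1` (`u^{k+1} − 1 = (u^k − 1)u + (u − 1)`, ultrametric). [folklore] -/
private theorem norm_pow_sub_one_lt {u : ℂ_[p]} (hu : ‖u - 1‖ < 1) (k : ℕ) : ‖u ^ k - 1‖ < 1 := by
  induction k with
  | zero => simp
  | succ n ih =>
    have h1 : u ^ (n + 1) - 1 = (u ^ n - 1) * u + (u - 1) := by ring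
    rw [h1]
    refine (IsUltrametricDist.norm_add_le_max _ _).trans_lt (max_lt ?_ hu)
    rw [norm_mul, norm_eq_one_of_norm_sub_one_lt hu, mul_one]
    exact ih

/-- **Leading term + tail**: for `‖u − 1‖ < 1`, `[T^k](unitTwist Q u) = [T^k]Q · u^k + ∑_{j > k} (…)`,
the tail having norm `≤ ‖u − 1‖`. [cite: deShalit1987, II.4.17 (52) (p. 77)] -/
theorem coe_coeff_unitTwist_eq_add {u : PadicComplexInt p} (hu : ‖(u : ℂ_[p]) - 1‖ < 1) (k : ℕ) :
    ∃ t : ℂ_[p], ‖t‖ ≤ ‖(u : ℂ_[p]) - 1‖ ∧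
      ((PowerSeries.coeff k (unitTwist Q u) : PadicComplexInt p) : ℂ_[p]) =
        ((PowerSeries.coeff k Q : PadicComplexInt p) : ℂ_[p]) * (u : ℂ_[p]) ^ k + t := by
  refine ⟨∑' i : ℕ, twistTerm Q (u : ℂ_[p]) k (i + (k + 1)), ?_, ?_⟩
  · refine IsUltrametricDist.norm_tsum_le_of_forall_le_of_nonneg (norm_nonneg _) fun i => ?_
    refine (norm_twistTerm_le Q hu k _).trans ?_
    have hik : i + (k + 1) - k = i + 1 := by omega
    rw [hik]
    exact pow_le_of_le_one (norm_nonneg _) hu.le (Nat.succ_ne_zero i)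
  · rw [coe_coeff_unitTwist Q hu, ← (summable_twistTerm Q hu k).sum_add_tsum_nat_add (k + 1),
      Finset.sum_range_succ, Finset.sum_eq_zero fun j hj => ?_]
    · simp [twistTerm]
    · exact twistTerm_eq_zero_of_lt Q _ (Finset.mem_range.mp hj)

/-- **The unit twist does not change which coefficients are units** (`‖u − 1‖ < 1`): `[T^k]` of
`unitTwist Q u` is a unit of `𝒪_{ℂ_p}` iff `[T^k]Q` is (leading term of the same norm, tail of norm
`< 1`). [cite: GreenbergVatsal2000, p. 2, (2)] [cite: deShalit1987, II.4.17 (52) (p. 77)] -/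
theorem isUnit_coeff_unitTwist_iff {u : PadicComplexInt p} (hu : ‖(u : ℂ_[p]) - 1‖ < 1) (k : ℕ) :
    IsUnit (PowerSeries.coeff k (unitTwist Q u)) ↔ IsUnit (PowerSeries.coeff k Q) := by
  obtain ⟨t, ht, heq⟩ := coe_coeff_unitTwist_eq_add Q hu k
  rw [isUnit_padicComplexInt_iff, isUnit_padicComplexInt_iff, heq,
    norm_add_eq_one_iff_of_norm_lt_one _ (ht.trans_lt hu), norm_mul, norm_pow,
    norm_eq_one_of_norm_sub_one_lt hu, one_pow, mul_one]
  rw [norm_mul, norm_pow, norm_eq_one_of_norm_sub_one_lt hu, one_pow, mul_one]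
  exact norm_coe_padicComplexInt_le_one _

/-- **The unit twist preserves unit content** (`μ = 0`). [cite: GreenbergVatsal2000, p. 2, (2)] -/
theorem hasUnitContent_unitTwist_iff {u : PadicComplexInt p} (hu : ‖(u : ℂ_[p]) - 1‖ < 1) :
    HasUnitContent (unitTwist Q u) ↔ HasUnitContent Q :=
  exists_congr fun k => isUnit_coeff_unitTwist_iff Q hu k

/-- **The unit twist is the identity modulo `𝔪`**: `(unitTwist Q u) mod 𝔪 = Q mod 𝔪` coefficientwise
(`u ≡ 1`, tail `≡ 0`) — so the index of the first unit coefficient (the analytic `λ` when `μ = 0`) is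
unchanged. [cite: GreenbergVatsal2000, p. 2, (1)–(2)] [cite: CastellaGrossiLeeSkinner2022, proof of Thm. 2.2.2, (2.16)] -/
theorem map_residue_unitTwist {u : PadicComplexInt p} (hu : ‖(u : ℂ_[p]) - 1‖ < 1) :
    PowerSeries.map (IsLocalRing.residue (PadicComplexInt p)) (unitTwist Q u) =
      PowerSeries.map (IsLocalRing.residue (PadicComplexInt p)) Q := by
  ext k
  rw [PowerSeries.coeff_map, PowerSeries.coeff_map]
  -- `[T^k](twist) - [T^k]Q = [T^k]Q (u^k - 1) + t` has norm `< 1`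
  obtain ⟨t, ht, heq⟩ := coe_coeff_unitTwist_eq_add Q hu k
  apply residue_eq_of_norm_sub_lt_one
  rw [heq]
  have hrw : ((PowerSeries.coeff k Q : PadicComplexInt p) : ℂ_[p]) * (u : ℂ_[p]) ^ k + t -
      ((PowerSeries.coeff k Q : PadicComplexInt p) : ℂ_[p]) =
        ((PowerSeries.coeff k Q : PadicComplexInt p) : ℂ_[p]) * ((u : ℂ_[p]) ^ k - 1) + t := by ring
  rw [hrw]
  refine (IsUltrametricDist.norm_add_le_max _ _).trans_lt (max_lt ?_ (ht.trans_lt hu))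
  rw [norm_mul]
  calc ‖((PowerSeries.coeff k Q : PadicComplexInt p) : ℂ_[p])‖ * ‖(u : ℂ_[p]) ^ k - 1‖
      ≤ 1 * ‖(u : ℂ_[p]) ^ k - 1‖ :=
        mul_le_mul_of_nonneg_right (norm_coe_padicComplexInt_le_one _) (norm_nonneg _)
    _ < 1 := by rw [one_mul]; exact norm_pow_sub_one_lt hu k

/-- **A line parallel to the inner axis has the same reduction as the axis**: for `‖c‖ < 1`,
`(lineSubst c G) mod 𝔪 = (constantCoeff G) mod 𝔪` coefficientwise (the residue form of
`isUnit_coeff_lineSubst_iff`: the tail `∑_{i ≥ 1} [T₁^i T₂^k]G c^i` has norm `≤ ‖c‖ < 1`).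
[cite: GreenbergVatsal2000, p. 2, (1)–(2)] [cite: deShalit1987, II.4.17 (51)–(54) (p. 77–78)] -/
theorem map_residue_lineSubst {c : PadicComplexInt p} (hc : ‖(c : ℂ_[p])‖ < 1) :
    PowerSeries.map (IsLocalRing.residue (PadicComplexInt p)) (lineSubst c G) =
      PowerSeries.map (IsLocalRing.residue (PadicComplexInt p)) (PowerSeries.constantCoeff G) := by
  ext k
  rw [PowerSeries.coeff_map, PowerSeries.coeff_map]
  apply residue_eq_of_norm_sub_lt_one
  rw [coe_coeff_lineSubst, (summable_coeff_mul_pow G hc k).tsum_eq_zero_add, pow_zero, mul_one,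
    PowerSeries.coeff_zero_eq_constantCoeff_apply, add_sub_cancel_left]
  exact (norm_tsum_coeff_mul_pow_succ_le G hc.le k).trans_lt hc

/-- **The twisted parallel line has the same reduction as the inner axis `T₂ = 0`**: for
`‖a‖ < 1`, `‖u − 1‖ < 1`,
`(unitTwist (lineSubst a Gᵗ) u) mod 𝔪 = (PowerSeries.map constantCoeff G) mod 𝔪` — hence the same
unit content (`μ = 0`) and the same first-unit-coefficient index as the line of the (F)-file's
`IsKatzMeasure₂.isKatzBranch_map_constantCoeff`: CGLS (2.16) "`λ(𝓛_ψ) = λ(𝓛_φ)`" in the tree's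
currency. [cite: CastellaGrossiLeeSkinner2022, proof of Thm. 2.2.2, (2.16)] [cite: GreenbergVatsal2000, p. 2, (1)–(2)] -/
theorem map_residue_unitTwist_lineSubst_transpose {a u : PadicComplexInt p} (ha : ‖(a : ℂ_[p])‖ < 1)
    (hu : ‖(u : ℂ_[p]) - 1‖ < 1) :
    PowerSeries.map (IsLocalRing.residue (PadicComplexInt p)) (unitTwist (lineSubst a (transpose G)) u) =
      PowerSeries.map (IsLocalRing.residue (PadicComplexInt p))
        (PowerSeries.map PowerSeries.constantCoeff G) := by
  rw [map_residue_unitTwist _ hu, map_residue_lineSubst _ ha, constantCoeff_transpose]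

/-- The same, in unit-content (`μ = 0`) currency. [cite: GreenbergVatsal2000, p. 2, (2)] -/
theorem hasUnitContent_unitTwist_lineSubst_transpose_iff {a u : PadicComplexInt p}
    (ha : ‖(a : ℂ_[p])‖ < 1) (hu : ‖(u : ℂ_[p]) - 1‖ < 1) :
    HasUnitContent (unitTwist (lineSubst a (transpose G)) u) ↔
      HasUnitContent (PowerSeries.map PowerSeries.constantCoeff G) := by
  rw [hasUnitContent_unitTwist_iff _ hu, hasUnitContent_lineSubst_iff _ ha, constantCoeff_transpose]

end IntSeries

/-! ### §4. Values of the twisted parallel line, and the branch-of-a-twist corollary for the frame -/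

namespace IntSeries

variable (G : PowerSeries (PowerSeries (PadicComplexInt p)))

/-- **Values of the twisted parallel line** (`‖a‖ < 1`, `‖u − 1‖ < 1`, `‖y‖ < 1`):
`P := unitTwist (lineSubst a Gᵗ) u` has value `w` at `y` iff `G` has value `w` at `(u(1+y) − 1, a)`.
[cite: deShalit1987, II.4.17 (52)–(54) (p. 77–78)] -/
theorem hasValueAt_unitTwist_lineSubst_transpose_iff {a u : PadicComplexInt p}
    (ha : ‖(a : ℂ_[p])‖ < 1) (hu : ‖(u : ℂ_[p]) - 1‖ < 1) {y : ℂ_[p]} (hy : ‖y‖ < 1) (w : ℂ_[p]) :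
    IntSeries.HasValueAt (unitTwist (lineSubst a (transpose G)) u) y w ↔
      IntSeries.HasValueAt₂ G ((u : ℂ_[p]) * (1 + y) - 1) a w := by
  have hx : ‖(u : ℂ_[p]) * (1 + y) - 1‖ < 1 := by
    have h1 : (u : ℂ_[p]) * (1 + y) - 1 = ((u : ℂ_[p]) - 1) + (u : ℂ_[p]) * y := by ring
    rw [h1]
    refine (IsUltrametricDist.norm_add_le_max _ _).trans_lt (max_lt hu ?_)
    rw [norm_mul, norm_eq_one_of_norm_sub_one_lt hu, one_mul]
    exact hy
  rw [hasValueAt_unitTwist_iff _ hu hy, hasValueAt_lineSubst_transpose_iff G ha hx]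

end IntSeries

section FrameCorollary

open NumberField IsDedekindDomain Field
open Literature.NumberTheory.GaloisRepresentations

variable {K : Type} [Field K] [NumberField K]
  {ι : PadicAlgCl p ≃+* ℂ} {v vbar : HeightOneSpectrum (𝓞 K)} {S : Finset (HeightOneSpectrum (𝓞 K))}
  {κ₁ κ₂ : ZpExtension K p} {γ₁ γ₂ : absoluteGaloisGroup K}
  {lam η : HeckeCharacter K} {Ω δ : ℂ} {Ωp : ℂ_[p]} {G : PowerSeries (PowerSeries (PadicComplexInt p))}

/-- **The `κ₁`-branch of a twist `λη` is a twisted parallel line of the `λ`-branch of the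
two-variable measure.** Let `G` be the `λ`-branch of the two-variable Katz–de Shalit measure for the
pair `(κ₁, κ₂; γ₁, γ₂)` (`IsKatzMeasure₂`), and let `η` be a Hecke character whose `p`-adic avatar
factors through the pair with `η̂(γ₁) = u ∈ 1 + 𝔪`, `η̂(γ₂) = 1 + a`, `a ∈ 𝔪` — supplied here as the
POINT TRANSPORT `hpt`: every point `(ρ, r)` of the `κ₁`-line (`ρ` through `κ₁` with avatar `r`) is
carried to a point `(ηρ, r')` of the pair with `r'(γ₁) = u·r(γ₁)` and `r'(γ₂) = 1 + a` (the consumer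
proves it from `IsPAdicAvatarOf`-multiplicativity; no avatar algebra is fixed in this file). Then
`P := unitTwist (lineSubst a Gᵗ) u ∈ 𝒪⟦T⟧` is the `κ₁`-BRANCH of the twist `λη` at `γ₁`
(`DeShalit1987.IsKatzBranch`): `P(r(γ₁) − 1) = G(u·r(γ₁) − 1, a) = L_{p,𝔣}(λ(ηρ)) = L_{p,𝔣}((λη)ρ)` —
de Shalit II.4.17 (52) "`L_{p,𝔣}(χ, s) = G(χ₀; χ₁(γ₀)⁻¹u^s − 1)`" for the two-variable function (54).
With §3, `P ≡ G(T, 0) (mod 𝔪)`. [cite: deShalit1987, II.4.17 (52)–(54) (p. 77–78)] -/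
theorem IsKatzMeasure₂.isKatzBranch_unitTwist_lineSubst
    (hG : IsKatzMeasure₂ ι v vbar S κ₁ κ₂ γ₁ γ₂ lam Ω δ Ωp G) {a u : PadicComplexInt p}
    (ha : ‖(a : ℂ_[p])‖ < 1) (hu : ‖(u : ℂ_[p]) - 1‖ < 1)
    (hpt : ∀ (ρ : HeckeCharacter K) (r : FramedGaloisRep K (PadicAlgCl p) 1),
      IsPAdicAvatarOf ι ρ r → FactorsThroughZp κ₁ r →
      ∃ r' : FramedGaloisRep K (PadicAlgCl p) 1,
        IsPAdicAvatarOf ι (η * ρ) r' ∧ FactorsThroughPair κ₁ κ₂ r' ∧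
          avatarValueAt r' γ₁ = (u : ℂ_[p]) * avatarValueAt r γ₁ ∧
          avatarValueAt r' γ₂ = 1 + (a : ℂ_[p]))
    (hnorm : ∀ (r : FramedGaloisRep K (PadicAlgCl p) 1), FactorsThroughZp κ₁ r →
      ‖avatarValueAt r γ₁ - 1‖ < 1) :
    DeShalit1987.IsKatzBranch ι v vbar S κ₁ γ₁ (lam * η) Ω δ Ωp
      (IntSeries.unitTwist (IntSeries.lineSubst a (IntSeries.transpose G)) u) := by
  intro ρ r m j hr hκ hjm hinf hunr hL
  obtain ⟨r', hr', hκ', h₁, h₂⟩ := hpt ρ r hr hκ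
  -- the pair frame at the transported point, for the character `λ(ηρ)` spelled as any `χ = λ(ηρ)`
  have key : ∀ (χ : HeckeCharacter K), χ = lam * (η * ρ) →
      ∀ hLχ : LFunction.HasEntireContinuation (heckeLFunction χ),
      IntSeries.HasValueAt₂ G (avatarValueAt r' γ₁ - 1) (avatarValueAt r' γ₂ - 1)
        (((ι.symm (DeShalit1987.interpolationValue p v vbar S χ m j Ω δ (hLχ.continuation 0)) :
            PadicAlgCl p) : ℂ_[p]) * Ωp ^ (m + j)) := by
    rintro χ rfl hLχ
    refine hG (η * ρ) r' m j hr' hκ' hjm ?_ ?_ hLχ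
    · rw [← mul_assoc]; exact hinf
    · intro w hw hw'; rw [← mul_assoc]; exact hunr w hw hw'
  have hval := key (lam * η * ρ) (mul_assoc _ _ _) hL
  rw [h₁, h₂, add_sub_cancel_left] at hval
  rw [IntSeries.hasValueAt_unitTwist_lineSubst_transpose_iff G ha hu (hnorm r hκ)]
  have hx : (u : ℂ_[p]) * (1 + (avatarValueAt r γ₁ - 1)) - 1 = (u : ℂ_[p]) * avatarValueAt r γ₁ - 1 := by
    ring
  rwa [hx]

end FrameCorollary

end Literature.NumberTheory.EllipticCurves

end
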